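import Summits.ResolutionOfSingularities.ResolutionOfSingularities.Theorems.PurelyInseparableDim4Straightening
import Summits.ResolutionOfSingularities.ResolutionOfSingularities.Theorems.PurelyInseparableDim4MohAlong
import Literature.AlgebraicGeometry.Resolution.OrdZeroBasics
import HarnessLib
import HarnessLib.Audit.Tags

/-!
# Purely inseparable hypersurfaces `z^q + F(x)` — STRAIGHTENING LEMMAS, part 2: moving a triangular
# substitution and the cleaning past the CHART TRANSFORM (G2, polynomial part)
# [OURS · counted 0 · cell res-dim4-pi · F4-I(3,3) band half · p-12's located reduction (ii) · p-9 (Lean)]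

Sequel of `PurelyInseparableDim4Straightening.lean` ((S1) shear conjugation, (S2) triangular substitutions
vs the chart map `σ_j`, (S3) cleaning vs substitutions).  The iteration of (S1)–(S3) along a
CONSTANT-CHART tail needs the same two commutations at the level of the chart TRANSFORM
`CentreBlowup.chartTransform q univ j` (= `σ_j` followed by division by `x_j^q`) rather than of `σ_j`:

* §1 **`subst_chartTransform_univ`**: for a family `ψ` fixed by `σ_j` (e.g. polynomials in `x_j`) and a
  `q`-fold `H` (`q ≤ ord_{univ} H`), `Θ'_ψ (chartTransform q univ j H) = chartTransform q univ j (Θ_{x_j ψ} H)`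
  (`Θ'_ψ : x_i ↦ x_i + ψ_i`, `Θ_{x_j ψ} : x_i ↦ x_i + x_j ψ_i`, `i ≠ j`) — one pass through the chart costs
  one power of `x_j`; `le_ordAlong_univ_aeval_of_constantCoeff_eq_zero` keeps the `q`-fold hypothesis.
* §2 **`deletePthPowers_chartTransform_aeval_deletePthPowers`** (characteristic `p`, exponent `q = p`, the
  class of record): `clean (chartTransform p S j (Θ (clean X))) = clean (chartTransform p S j (Θ X))` for
  every substitution `Θ` and every centre `S`, chart `j` — the deleted part is a `p`-th power, its image
  under `Θ` is one (Frobenius), the chart transform keeps `p`-th-power exponents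
  (`MohAlong.isPthPowerExponent_chartExponent`), and the final cleaning deletes them.

With part 1 these give the one-step form of the straightened recursion
`F_{k+1} = clean (chartTransform (shear_{b_k} F_k))` and let the shear of step `k+1` be pulled back
through step `k` as the triangular substitution `x_i ↦ x_i + b_i x_j²`; the `m`-step composite
(`Θ_m : x_i ↦ x_i + Σ_{l<m} b_{k₀+l,i} x_j^{l+1}`, the truncated arc) and p-12's quantitative
frozen-monomial bound remain OPEN (cell HANDOFF of res-dim4-p-9).  Nothing in this file is a statement
about resolution of singularities; resolution in dimension ≥ 4 / characteristic `p` is NOT proved anywhere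
in this programme; counted 0; AI formalisation, weaker than expert review.
bears_on: LADDER-RESOLUTION:D157-DOOR2 (res-dim4-pi · G2). Supports stmt-ResolutionOfSingularities-16155 (helper).
-/

set_option linter.dupNamespace false

noncomputable section

open MvPolynomial Finset

namespace Summit.ResolutionOfSingularities.ResolutionOfSingularities.Theorems.PIDim4.Straightening

open Literature.AlgebraicGeometry.Resolution
open Literature.AlgebraicGeometry.Resolution.Hauser2010
open Literature.AlgebraicGeometry.Resolution.CentreBlowup

/-! ## 1. Triangular substitutions pass the chart transform -/

section Subst

variable {σ : Type*} [Fintype σ] [DecidableEq σ] {K : Type*} [Field K]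

omit [DecidableEq σ] in
/-- A substitution without constant terms does not lower the order along the point. [folklore] -/
theorem le_ordAlong_univ_aeval_of_constantCoeff_eq_zero (θ : σ → MvPolynomial σ K)
    (hθ : ∀ i, constantCoeff (θ i) = 0) {q : ℕ} {H : MvPolynomial σ K}
    (hq : (q : ℕ∞) ≤ ordAlong Finset.univ H) : (q : ℕ∞) ≤ ordAlong Finset.univ (aeval θ H) := by
  rw [ordAlong_univ] at hq ⊢
  exact hq.trans (le_ordZero_aeval θ hθ H)

/-- **A triangular substitution passes the chart transform at the cost of one `x_j`**: for `ψ` fixed by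
`σ_j` and a `q`-fold `H`, `Θ'_ψ (chartTransform q univ j H) = chartTransform q univ j (Θ_{x_j ψ} H)`.
[folklore] -/
theorem subst_chartTransform_univ (q : ℕ) (j : σ) (ψ : σ → MvPolynomial σ K)
    (hψ : ∀ i, coordBlowupSubst K (Set.univ : Set σ) j (ψ i) = ψ i) (H : MvPolynomial σ K)
    (hq : (q : ℕ∞) ≤ ordAlong Finset.univ H) :
    aeval (fun i => if i = j then (X j : MvPolynomial σ K) else X i + ψ i)
        (chartTransform q Finset.univ j H) =
      chartTransform q Finset.univ j
        (aeval (fun i => if i = j then (X j : MvPolynomial σ K) else X i + X j * ψ i) H) := by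
  classical
  have hj : j ∈ (Finset.univ : Finset σ) := Finset.mem_univ j
  have huniv : ((Finset.univ : Finset σ) : Set σ) = Set.univ := Finset.coe_univ
  -- the inner substitution keeps `q`-foldness
  have hq' : (q : ℕ∞) ≤ ordAlong Finset.univ
      (aeval (fun i => if i = j then (X j : MvPolynomial σ K) else X i + X j * ψ i) H) :=
    le_ordAlong_univ_aeval_of_constantCoeff_eq_zero _ (fun i => by
      by_cases hij : i = j
      · simp [hij]
      · simp [hij]) hq
  have h1 := ChartDictionary.coordBlowupSubst_eq_X_pow_mul_chartTransform (K := K) hj q H hq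
  have h2 := ChartDictionary.coordBlowupSubst_eq_X_pow_mul_chartTransform (K := K) hj q _ hq'
  rw [huniv] at h1 h2
  -- `σ_j ∘ Θ_{x_j ψ} = Θ'_ψ ∘ σ_j` applied to `H`
  have hcomp := congrArg (fun φ : MvPolynomial σ K →ₐ[K] MvPolynomial σ K => φ H)
    (coordBlowupSubst_comp_subst (K := K) j ψ hψ)
  simp only [AlgHom.comp_apply] at hcomp
  rw [h1, map_mul, map_pow, aeval_X, if_pos rfl] at hcomp
  -- `hcomp : σ_j (Θ H) = x_j^q * Θ' (chartTransform H)`; compare with `h2`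
  rw [h2] at hcomp
  have hX : (X j : MvPolynomial σ K) ^ q ≠ 0 := pow_ne_zero _ (X_ne_zero j)
  exact (mul_left_cancel₀ hX hcomp).symm

end Subst

/-! ## 2. Cleaning passes the chart transform of a substituted polynomial (`q = p`) -/

section CleanChart

variable {σ : Type*} [DecidableEq σ] {K : Type*} [Field K] (p : ℕ) [hp : Fact p.Prime] [CharP K p]

/-- The chart transform of a `p`-th power cleans to zero: `Q^p = Σ a_m^p x^{p m}` and the chart law keeps
`p`-th-power exponents. [folklore] -/
theorem deletePthPowers_chartTransform_pow_char (S : Finset σ) (j : σ) (Q : MvPolynomial σ K) :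
    deletePthPowers p (chartTransform p S j (Q ^ p)) = 0 := by
  classical
  have hQ : Q ^ p = ∑ m ∈ Q.support, monomial (p • m) (coeff m Q ^ p) := by
    conv_lhs => rw [Q.as_sum]
    rw [sum_pow_char]
    refine Finset.sum_congr rfl fun m _ => ?_
    rw [monomial_pow]
  rw [hQ, chartTransform_sum, deletePthPowers_finset_sum]
  refine Finset.sum_eq_zero fun m _ => ?_
  rw [chartTransform_monomial, deletePthPowers_monomial, if_pos]
  refine MohAlong.isPthPowerExponent_chartExponent p S j ?_
  intro i _
  exact ⟨m i, by simp [Finsupp.smul_apply, smul_eq_mul]⟩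

/-- **Cleaning passes the chart transform of a substituted polynomial** (characteristic `p`, exponent
`q = p`): for every substitution `Θ = aeval θ`, centre `S` and chart `j`,
`clean (chartTransform p S j (Θ (clean X))) = clean (chartTransform p S j (Θ X))`. [cite: Hauser2010, §G (cleaning)] -/
theorem deletePthPowers_chartTransform_aeval_deletePthPowers (S : Finset σ) (j : σ)
    (θ : σ → MvPolynomial σ K) (X0 : MvPolynomial σ K) :
    deletePthPowers p (chartTransform p S j (aeval θ (deletePthPowers p X0))) =
      deletePthPowers p (chartTransform p S j (aeval θ X0)) := by
  classical
  have hsplit : X0 = deletePthPowers p X0 +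
      ∑ d ∈ X0.support with IsPthPowerExponent p d, monomial d (coeff d X0) := by
    conv_lhs => rw [X0.as_sum]
    rw [← Finset.sum_filter_add_sum_filter_not X0.support (IsPthPowerExponent p), add_comm]
    rfl
  conv_rhs => rw [hsplit]
  rw [map_add, chartTransform_add, deletePthPowers_add, map_sum, chartTransform_sum,
    deletePthPowers_finset_sum, Finset.sum_eq_zero, add_zero]
  intro d hd
  obtain ⟨Q, hQ⟩ := aeval_monomial_eq_pow_of_isPthPowerExponent p θ (Finset.mem_filter.mp hd).2
    (coeff d X0)
  rw [hQ, MvPolynomial.smul_eq_C_mul, chartTransform_C_mul, ← MvPolynomial.smul_eq_C_mul,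
    deletePthPowers_smul, deletePthPowers_chartTransform_pow_char, smul_zero]

end CleanChart

end Summit.ResolutionOfSingularities.ResolutionOfSingularities.Theorems.PIDim4.Straightening

end
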